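import Summits.BirchSwinnertonDyer.BirchSwinnertonDyer.Theorems.SmallImageMuTransferMuTransferX9CoreStepOne
import Summits.BirchSwinnertonDyer.BirchSwinnertonDyer.Theorems.KatoDescentPotSupersingularMuCoreIrrStepOne
import HarnessLib

/-!
# The K6 `μ`-core under IMAGE FACTS instead of `ρ̄` not onto — part C: STEP 1 + LEMMA 4 (the joint value with
# non-degenerate Weil pairing coefficients), at every odd prime
# (route `KatoDescentPotSupersingular`, U₀ parent item stmt-BirchSwinnertonDyer-19197 / U₀-ns node 19189;
# route-free helper)

Seat `bsd-potss-k9-c4` g14 (prover; cell `bsd-potss`); `--supports stmt-BirchSwinnertonDyer-19197 --as helper`;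
closes nothing.  HONEST FRAMING: BSD is not proved by any of this; nothing is booked; THEOREMS ONLY; the
mathematics and the proof text are the K6 cell's (`bsd-smallim` k6-c2 g3, `…X9CoreStepOne`, MU-TRANSFER-PROOF
§4 Lemma 4 / §5 Step 1); this file only re-keys the hypothesis `¬ W.HasSurjectiveModNGaloisRep p` into the two
image facts (SC) (a Galois scalar `≠ 1` on `E[p]`) and (IF) (no normal index-`p` subgroup of `Γ_ℚ` above
`ker ρ̄_{E,p}`), both theorems at `p = 3` for every `E[3]`-irreducible curve (parts A/B:
`…MuCoreIrrImageFacts`, `…MuCoreIrrStepOne`).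

* `exists_jointValue_weil_ne_zero_of_imageFacts` — the Step-1/Lemma-4 block of the core, verbatim from
  `exists_jointValue_weil_ne_zero_of_ne_two` with the two Step-1 inputs and the topological generator fixing
  `E[p]` taken from parts A/B.

References: [MazurRubin2004] §5.3; [Serre1972] §2.4 Prop. 15, §2.6; [SilvermanAEC2009] III.8.1.
-/

set_option linter.dupNamespace false
set_option autoImplicit false

noncomputable section

open scoped Classical NumberField
open WeierstrassCurve Field IsDedekindDomain
open Literature.NumberTheory.GaloisRepresentations
open Literature.NumberTheory.GaloisCohomology
open Literature.NumberTheory.EllipticCurves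
open Summit.BirchSwinnertonDyer.BirchSwinnertonDyer.Rank1Residual

namespace Summit.BirchSwinnertonDyer.BirchSwinnertonDyer.Rank1Residual.CoreAssembly

/-- **MU-TRANSFER-PROOF §5 STEP 1 with §4 LEMMA 4 under IMAGE FACTS** (twin of
`exists_jointValue_weil_ne_zero_of_ne_two`, with (SC)+(IF) in place of `ρ̄_{E,p}` not onto; K6 proof text
verbatim otherwise): for `κ' ∈ 𝐇¹_Ω` with `κ̄' ≠ 0`, a cocycle `φ` of `κ'_e`, a cocycle `ψ` of a class of the dual
twist with `T^{e−1}[ψ] ≠ 0`, and a Weil pairing `e_W`, some joint value `z = (φ τ, ψ τ)` on the joint kernel has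
its two lowest pairing coefficients not both zero.  At `p = 3` the image facts hold for EVERY `E[3]`-irreducible
curve (part A §5). [cite: MazurRubin2004, §5.3] [cite: Serre1972, §2.4 Prop. 15, §2.6]
[cite: SilvermanAEC2009, Prop. III.8.1] -/
theorem exists_jointValue_weil_ne_zero_of_imageFacts (W : WeierstrassCurve ℚ) [W.IsElliptic]
    [W.IsGloballyMinimal] (p : ℕ) [Fact p.Prime] (κ : ZpExtension ℚ p)
    (hp2 : p ≠ 2) (hirr : W.HasIrreducibleModPGaloisRep p)
    (hSC : ∃ (z : absoluteGaloisGroup ℚ) (a : ZMod p), a ≠ 1 ∧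
      ∀ P : WeierstrassCurve.geomTorsion W (p : ℤ), z • P = a.val • P)
    (hIF : ∀ N : Subgroup (absoluteGaloisGroup ℚ), N.Normal →
      (WeierstrassCurve.galoisRepTorsion W (p : ℕ)).ker ≤ N → N.index ≠ p)
    (κ' : κ.twistTower (W.torsionGaloisModule (p : ℤ))
      (fun P : WeierstrassCurve.geomTorsion W (p : ℤ) => AddSubgroup.torsionBy.nsmul P))
    (hκ'c : κ.towerConst (W.torsionGaloisModule (p : ℤ)) (fun P => AddSubgroup.torsionBy.nsmul P) κ' ≠ 0)
    {e' : ℕ} (he1 : 1 < e' + 1) (φ : contOneCocycles (W.modPTwist p κ (e' + 1)).toTopRep)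
    (hφ : oneCocycleClass (W.modPTwist p κ (e' + 1)).toTopRep φ = κ'.1 (e' + 1))
    (ψ : contOneCocycles (W.modPTwist p κ.invTwist (e' + 1)).toTopRep)
    (hψT : (κ.invTwist.shiftH1 (W.torsionGaloisModule (p : ℤ))
      (fun P : WeierstrassCurve.geomTorsion W (p : ℤ) => AddSubgroup.torsionBy.nsmul P) (e' + 1))^[e']
        (oneCocycleClass (W.modPTwist p κ.invTwist (e' + 1)).toTopRep ψ) ≠ 0)
    (eW : WeierstrassCurve.geomTorsion W (p : ℤ) → WeierstrassCurve.geomTorsion W (p : ℤ) →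
      AlgebraicClosure ℚ)
    (hμ : ∀ S T, eW S T ^ p = 1) (hadd₁ : ∀ S₁ S₂ T, eW (S₁ + S₂) T = eW S₁ T * eW S₂ T)
    (hadd₂ : ∀ S T₁ T₂, eW S (T₁ + T₂) = eW S T₁ * eW S T₂) (hnondeg : ∀ T, (∀ S, eW S T = 1) → T = 0) :
    haveI : NeZero p := ⟨(Fact.out : p.Prime).ne_zero⟩
    ∃ z ∈ contOneCocycles.jointValueSubgroup φ ψ
      ((κ.twistModPRepresentation (W.torsionGaloisModule (p : ℤ))
          (fun P : WeierstrassCurve.geomTorsion W (p : ℤ) => AddSubgroup.torsionBy.nsmul P) (e' + 1)).ker ⊓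
        (κ.invTwist.twistModPRepresentation (W.torsionGaloisModule (p : ℤ))
          (fun P : WeierstrassCurve.geomTorsion W (p : ℤ) => AddSubgroup.torsionBy.nsmul P) (e' + 1)).ker)
      (fun _ hτ x => κ.toTopRep_ρ_apply_eq_self_of_mem_ker (W.torsionGaloisModule (p : ℤ)) _ (e' + 1)
        (Subgroup.mem_inf.mp hτ).1 x)
      (fun _ hτ y => κ.invTwist.toTopRep_ρ_apply_eq_self_of_mem_ker (W.torsionGaloisModule (p : ℤ)) _
        (e' + 1) (Subgroup.mem_inf.mp hτ).2 y),
      weilPairingHom W p eW hμ hadd₁ hadd₂ (z.1 ⟨0, by omega⟩) (z.2 ⟨0, by omega⟩) ≠ 0 ∨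
      weilPairingHom W p eW hμ hadd₁ hadd₂ (z.1 ⟨0, by omega⟩) (z.2 ⟨1, he1⟩) +
        weilPairingHom W p eW hμ hadd₁ hadd₂ (z.1 ⟨1, he1⟩) (z.2 ⟨0, by omega⟩) ≠ 0 := by
  have hp : p.Prime := Fact.out
  haveI : Finite (WeierstrassCurve.geomTorsion W (p : ℤ)) :=
    WeierstrassCurve.finite_torsionPoints_holds W (AlgebraicClosure ℚ) (by exact_mod_cast hp.ne_zero)
  haveI : NeZero p := ⟨hp.ne_zero⟩
  set H : Subgroup (absoluteGaloisGroup ℚ) :=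
    (κ.twistModPRepresentation (W.torsionGaloisModule (p : ℤ))
        (fun P : WeierstrassCurve.geomTorsion W (p : ℤ) => AddSubgroup.torsionBy.nsmul P) (e' + 1)).ker ⊓
      (κ.invTwist.twistModPRepresentation (W.torsionGaloisModule (p : ℤ))
        (fun P : WeierstrassCurve.geomTorsion W (p : ℤ) => AddSubgroup.torsionBy.nsmul P) (e' + 1)).ker
    with hHdef
  have hX : ∀ τ ∈ H, ∀ x : (W.modPTwist p κ (e' + 1)).toTopRep,
      (W.modPTwist p κ (e' + 1)).toTopRep.ρ τ x = x := fun _ hτ x =>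
    κ.toTopRep_ρ_apply_eq_self_of_mem_ker (W.torsionGaloisModule (p : ℤ)) _ (e' + 1)
      (Subgroup.mem_inf.mp hτ).1 x
  have hY : ∀ τ ∈ H, ∀ y : (W.modPTwist p κ.invTwist (e' + 1)).toTopRep,
      (W.modPTwist p κ.invTwist (e' + 1)).toTopRep.ρ τ y = y := fun _ hτ y =>
    κ.invTwist.toTopRep_ρ_apply_eq_self_of_mem_ker (W.torsionGaloisModule (p : ℤ)) _ (e' + 1)
      (Subgroup.mem_inf.mp hτ).2 y
  have hφtop : contOneCocycles.valueSubgroup φ H hX = ⊤ :=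
    LevelE.valueSubgroup_inf_eq_top_of_towerConst_ne_zero_of_imageFacts W p κ κ.invTwist hirr hSC hIF κ'
      hκ'c e' (e' + 1) φ hφ
  have hψtop : contOneCocycles.valueSubgroup ψ H hY = ⊤ :=
    LevelE.valueSubgroup_inf_eq_top_of_shiftH1_iterate_ne_zero_of_imageFacts W p κ κ.invTwist hirr hSC hIF
      (e' + 1) e' ψ hψT
  haveI hHn : H.Normal := by rw [hHdef]; infer_instance
  obtain ⟨γ₀, hγ₀, hγ₀E⟩ := exists_isTopGenerator_forall_smul_eq_of_IF W p κ hIF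
  classical
  letI : Module (ZMod p) (WeierstrassCurve.geomTorsion W (p : ℤ)) := AddSubgroup.torsionBy.zmodModule
  set Mj := contOneCocycles.jointValueSubgroup φ ψ H hX hY with hMjdef
  let Mk : Submodule (ZMod p)
      ((Fin (e' + 1) → WeierstrassCurve.geomTorsion W (p : ℤ)) ×
        (Fin (e' + 1) → WeierstrassCurve.geomTorsion W (p : ℤ))) :=
    AddSubgroup.toZModSubmodule p Mj
  have hMkmem : ∀ z, z ∈ Mk ↔ z ∈ Mj := fun z => AddSubgroup.mem_toZModSubmodule p
  let T : (Fin (e' + 1) → WeierstrassCurve.geomTorsion W (p : ℤ)) →ₗ[ZMod p]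
      (Fin (e' + 1) → WeierstrassCurve.geomTorsion W (p : ℤ)) :=
    ((W.modPTwist p κ (e' + 1) γ₀).toAddMonoidHom - AddMonoidHom.id _).toZModLinearMap p
  let D : (Fin (e' + 1) → WeierstrassCurve.geomTorsion W (p : ℤ)) →ₗ[ZMod p]
      (Fin (e' + 1) → WeierstrassCurve.geomTorsion W (p : ℤ)) :=
    ((W.modPTwist p κ.invTwist (e' + 1) γ₀).toAddMonoidHom - AddMonoidHom.id _).toZModLinearMap p
  have hfix : ∀ x : Fin (e' + 1) → WeierstrassCurve.geomTorsion W (p : ℤ),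
      (fun i => W.torsionGaloisModule (p : ℤ) γ₀ (x i)) = x := fun x =>
    funext fun i => by rw [WeierstrassCurve.torsionGaloisModule_apply_apply, hγ₀E]
  have hTapply : ∀ x, T x = W.modPTwist p κ (e' + 1) γ₀ x - fun i => W.torsionGaloisModule (p : ℤ) γ₀ (x i) :=
    fun x => by rw [hfix]; rfl
  have hDapply : ∀ y, D y =
      W.modPTwist p κ.invTwist (e' + 1) γ₀ y - fun i => W.torsionGaloisModule (p : ℤ) γ₀ (y i) :=
    fun y => by rw [hfix]; rfl
  have hT0 : ∀ x, T x ⟨0, by omega⟩ = 0 := fun x => by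
    rw [hTapply]; exact LevelE.twistModP_sub_apply_zero κ _ _ (e' + 1) hγ₀ (by omega) x
  have hT1 : ∀ x, T x ⟨1, he1⟩ = x ⟨0, by omega⟩ := fun x => by
    rw [hTapply]
    refine (LevelE.twistModP_sub_apply_one κ _ _ (e' + 1) hγ₀ he1 x).trans ?_
    rw [WeierstrassCurve.torsionGaloisModule_apply_apply, hγ₀E]
  have hD0 : ∀ y, D y ⟨0, by omega⟩ = 0 := fun y => by
    rw [hDapply]; exact LevelE.invTwist_twistModP_sub_apply_zero κ _ _ (e' + 1) hγ₀ (by omega) y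
  have hD1 : ∀ y, D y ⟨1, he1⟩ = -y ⟨0, by omega⟩ := fun y => by
    rw [hDapply]
    refine (LevelE.invTwist_twistModP_sub_apply_one κ _ _ (e' + 1) hγ₀ he1 y).trans ?_
    rw [WeierstrassCurve.torsionGaloisModule_apply_apply, hγ₀E]
  have hMkT : ∀ z ∈ Mk, (T z.1, D z.2) ∈ Mk := by
    intro z hz
    rw [hMkmem] at hz ⊢
    have h1 := contOneCocycles.smul_mem_jointValueSubgroup φ ψ H hX hY γ₀ hz
    exact LevelE.sub_mem_of_prod_stable (W.modPTwist p κ (e' + 1) γ₀).toAddMonoidHom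
      (W.modPTwist p κ.invTwist (e' + 1) γ₀).toAddMonoidHom Mj (fun w hw =>
        contOneCocycles.smul_mem_jointValueSubgroup φ ψ H hX hY γ₀ hw) hz
  have h1M : ∀ v : WeierstrassCurve.geomTorsion W (p : ℤ), ∃ z ∈ Mk, z.1 ⟨0, by omega⟩ = v := by
    intro v
    obtain ⟨z, hz, hz1⟩ := contOneCocycles.exists_mem_jointValueSubgroup_fst_eq φ ψ H hX hY hφtop
      (fun i => if (i : ℕ) = 0 then v else 0)
    exact ⟨z, (hMkmem z).2 hz, by rw [hz1]; simp⟩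
  have h2M : ∀ v : WeierstrassCurve.geomTorsion W (p : ℤ), ∃ z ∈ Mk, z.2 ⟨0, by omega⟩ = v := by
    intro v
    obtain ⟨z, hz, hz2⟩ := contOneCocycles.exists_mem_jointValueSubgroup_snd_eq φ ψ H hX hY hψtop
      (fun i => if (i : ℕ) = 0 then v else 0)
    exact ⟨z, (hMkmem z).2 hz, by rw [hz2]; simp⟩
  haveI : NeZero p := ⟨hp.ne_zero⟩
  set eWH := weilPairingHom W p eW hμ hadd₁ hadd₂ with heWH
  set ι := muCarrierZModEquiv ℚ p with hι
  set evAdd : WeierstrassCurve.geomTorsion W (p : ℤ) →+ WeierstrassCurve.geomTorsion W (p : ℤ) →+ ZMod p :=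
    eWH.flip.compr₂ ι.toAddMonoidHom with hevAdd
  let ev : WeierstrassCurve.geomTorsion W (p : ℤ) →ₗ[ZMod p]
      WeierstrassCurve.geomTorsion W (p : ℤ) →ₗ[ZMod p] ZMod p :=
    LinearMap.mk₂ (ZMod p) (fun y v => evAdd y v)
      (fun y₁ y₂ v => by rw [evAdd.map_add]; rfl)
      (fun c y v => ZMod.map_smul (evAdd.flip v) c y)
      (fun y v₁ v₂ => (evAdd y).map_add v₁ v₂)
      (fun c y v => ZMod.map_smul (evAdd y) c v)
  have hev_apply : ∀ y v, ev y v = ι (eWH v y) := fun _ _ => rfl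
  have hev : ∃ y v, ev y v ≠ 0 := by
    have hcard : 1 < Nat.card (WeierstrassCurve.geomTorsion W (p : ℤ)) := by
      rw [W.natCard_geomTorsion (n := (p : ℤ)) (by exact_mod_cast hp.ne_zero), Int.natAbs_natCast]
      nlinarith [hp.one_lt]
    haveI := Finite.one_lt_card_iff_nontrivial.mp hcard
    obtain ⟨T₀, hT₀⟩ := exists_ne (0 : WeierstrassCurve.geomTorsion W (p : ℤ))
    have hS : ∃ S, eW S T₀ ≠ 1 := by
      by_contra h
      push Not at h
      exact hT₀ (hnondeg T₀ h)
    obtain ⟨S, hS⟩ := hS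
    refine ⟨T₀, S, ?_⟩
    rw [hev_apply]
    intro h0
    apply hS
    have h1 : eWH S T₀ = 0 := ι.map_eq_zero_iff.mp h0
    rw [heWH, muCarrier_eq_iff, coe_weilPairingHom] at h1
    exact h1
  have h2k : (2 : ZMod p) ≠ 0 := by
    have h : ((2 : ℕ) : ZMod p) ≠ 0 := by
      rw [Ne, ZMod.natCast_eq_zero_iff]
      intro hdvd
      have := Nat.le_of_dvd two_pos hdvd
      have := hp.two_le
      omega
    exact_mod_cast h
  obtain ⟨z, hzM, hz01⟩ := LevelE.exists_mem_pairingCoeff_ne_zero (e := e' + 1) h2k (by omega) ev hev T D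
    hT0 hT1 hD0 hD1 Mk hMkT h1M h2M
  refine ⟨z, (hMkmem z).1 hzM, ?_⟩
  rw [hev_apply, hev_apply, hev_apply, ← map_add] at hz01
  rcases hz01 with h0 | h1
  · exact Or.inl fun h => h0 (by rw [h, map_zero])
  · exact Or.inr fun h => h1 (by rw [add_comm, h, map_zero])

end Summit.BirchSwinnertonDyer.BirchSwinnertonDyer.Rank1Residual.CoreAssembly

end
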